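import Literature.NumberTheory.GaloisCohomology.Howard2004.DegreeTwoInertProofs
import Literature.NumberTheory.GaloisCohomology.Howard2004.DVRSettingLevelTrivialityProofs
import Literature.NumberTheory.GaloisCohomology.Howard2004.DVRSettingFrobeniusCharacterProofs
import Literature.NumberTheory.GaloisCohomology.Howard2004.ResidualSelmerEigenpartsProofs
import Literature.NumberTheory.GaloisCohomology.RestrictedRamificationCdTwoOfPoitouTateReal
import HarnessLib

/-!
# Howard 2004, §1.6 on a `DVRSetting`: the LOCAL ARITHMETIC at a Kolyvagin prime `q ∈ 𝓛^{(j)}` of the level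
# module `T^{(j)}` — the local binders of Prop. 1.5.9 / Lemma 1.5.6 / H.4-at-`λ ∣ n`, DISCHARGED (proofs file)

Topic `NumberTheory/GaloisCohomology/Howard2004` (sequel to `DegreeTwoInertProofs` (Prop. 1.1.9 at a degree-two prime),
`DVRSettingLevelTrivialityProofs` (HTRIV: `Γ_{K_λ}` acts trivially on `T^{(j)}` for `λ ∈ n ⊆ 𝓛^{(j)}`),
`DVRSettingFrobeniusCharacterProofs` and `ResidualSelmerEigenpartsProofs` (`σ • q = q` on `𝓛`)).  THEOREMS ONLY: no definition, no named fact, no instance, no notation, no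
`sorry`.

SOURCE / WHY.  B. Howard, *The Heegner point Kolyvagin system*, Compositio Math. **140** (2004) = arXiv:1202.6340.
The ENGINE of Lemma 1.6.4 (`StubLemmaInductionProofs.mem_stub_of_stubLemmaInduction_levels`) takes Prop. 1.5.9 as the
binder `h159`; the cell's kernel form of Prop. 1.5.9 at an inert Kolyvagin prime
(`DualityDatum.smul_le_ker_of_smul_le_ker_of_inert_local[_frob]`, and the Lemma 1.5.6 / isotropy / H.4 readers it rests
on) carries the LOCAL ARITHMETIC of `T` at the prime `q` as explicit binders: `hq : σ • q = q`, `htriv`/`htriv'`/`htrivTw`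
(trivial action of `Γ_{K_q}`, of `Γ_{K_{σq}}`, and on `Tw(T)`), `hp`/`hn` (`p`-power torsion of `T`), `hRk`/`hRp`/`hN`/`hRN`
(the level ring is killed by an odd `N = p^{k'}`), `σ₀`/`hcyc` (a tame generator modulo `Γ_{K[ℓ]}`), `hc`/`ef`/`etr`
(Prop. 1.1.9: `H¹(K_q,T) = H¹_ur ⊕ H¹_tr`, both `≅ (𝒪/ϖ^{kk})²`), `hcard` (`#H¹_tr · #H¹_tr = #H¹`), `h𝓕q`
(`𝓕_q = H¹_ur`), `hS`/`h𝓡S` (ramification bookkeeping of `Σ(F)`), `hinf` (no archimedean contribution).  Here ALL of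
these are discharged for `T := T^{(j)}` — the level-`j` module of a `DVRSetting S` with `S.SatisfiesH` — at a prime
`q ∈ S.levelPrimes j = 𝓛 ∩ 𝓛_{e_j}(T)` (⊇ the engine's `S.enginePrimes k` whenever `e_j ≤ 2e_k − 1`), under Howard's
standing hypothesis `d_K ≠ −3, −4` (arXiv p. 3 L24–25, p. 12 L129–130; as `NumberField.discr K < -4`) where
Prop. 1.1.9 needs `#Gal(K[ℓ]/K[1]) = ℓ + 1`.

* §0 (generic) `ConjugationDatum.toLocal_twist_apply_eq_self` — `htrivTw` from `htriv'` for ANY conjugation datum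
  (`cd.compat`).  (The binder `hq : σ • q = q` for `q ∈ 𝓛` is `DVRSetting.sigma_smul_eq_self_of_mem_L` of
  `ResidualSelmerEigenpartsProofs`, imported.)
* §1 `DVRSetting.isDegreeTwo_of_mem_L`, `natCast_p_not_mem_of_mem_L`, `isUnramifiedAt_of_mem_L`,
  `residueChar_sigma_smul_of_mem_L`, `pow_p_e_smul_eq_zero_level` / `exists_pow_p_smul_eq_zero_level` (hn / hp),
  `isPrimaryTorsion_levelRing` (hRp), `odd_pow_p` (hN), `residueChar_succ_smul_eq_zero_of_mem_levelPrimes`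
  (`(ℓ + 1) · T^{(j)} = 0`), `toLocal_twist_apply_eq_self_of_subset_levelPrimes` (htrivTw).
* §2 Prop. 1.1.9 AT THE LEVEL: `isCompl_unramifiedSubgroup_transverseStructure_of_mem_levelPrimes`,
  `natCard_transverseStructure_mul_eq_of_mem_levelPrimes` (hcard, `v' := σ • q`),
  `exists_mem_absInertia_forall_pow_inv_mul_mem_localRingClassSubgroup_of_mem_L` (σ₀ + hcyc),
  `nonempty_level_linearEquiv_pi` (`T^{(j)} ≃ₗ[R] (R/π^{e_j})²`, H.0),
  **`exists_unramified_transverse_submodules_of_mem_levelPrimes`** (hc/ef/etr in the exact shape of H159-LOC).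
* §3 `cond_inr_eq_unramifiedSubgroup_of_mem_L` (h𝓕q), `SelmerTriple.atLevel_cond` (rfl reading of `F(n)`),
  `not_mem_and_isUnramifiedAt_of_not_mem_Sigma` (hS), `SelmerTriple.isUnramifiedOutside_modify_cond` (h𝓡S),
  `subsingleton_galoisCohomology_toLocal_inl_level` / `localization_inl_eq_zero_level` (hinf, `p` odd).

NOT HERE (other owners / kept as binders by the assembler of `h159`): the duality side (`hΘ` =
`DVRSettingFrobeniusCharacterProofs.exists_toTateDual_bijective_level`, H.4 off `q`, `hδ`), the READ data
(`lam`/`exp`/`hfrob`/`hdet`), the Poitou–Tate package (`inv`, `hPT`, `hSC`, `hperf`), the datum facts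
(`hI`/`hφ`/`hφI`/`hφΛ`), `hsoc` (`QuotientDVRSocleCyclicProofs`), `hstab`.  `thm161_dvrKolyvaginBound` is NOT proved; no
summit statement is proved; the Birch–Swinnerton-Dyer conjecture is not proved by any of this.

Cell `pub/bsd-print-x9`, G87 = Howard Thm. 1.6.1 (print leaf `stub_h161` of stmt-BirchSwinnertonDyer-22642); seat
`bsd-line-x9-p1-w3` g15, brick (H159-S-LOCAL).

References: [Howard2004HeegnerKolyvagin] §1.2 (Kolyvagin primes, `K[ℓ]`), Prop. 1.1.9, Def. 1.1.8, Def. 1.2.2, §1.3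
(H.0, `Tw(T)`), §1.6 (arXiv:1202.6340 p. 5 L126–146, p. 6 L17–125, p. 7 L33–57, p. 11 L13–44); [GrossLMS1991] §3;
[NeukirchSchmidtWingberg2008] (8.6.10)(ii) (no odd cohomology at archimedean places).
-/

set_option autoImplicit false

noncomputable section

open Function NumberField IsDedekindDomain IsDedekindDomain.HeightOneSpectrum Field
open scoped NumberField

namespace Literature.NumberTheory.GaloisCohomology.Howard2004

open Literature.NumberTheory.GaloisRepresentations
open Literature.NumberTheory.GaloisRepresentations.DiscreteGaloisModule
open Literature.NumberTheory.EllipticCurves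

/-! ## §0 Generic: `Tw(T)` is locally trivial where `T` is -/

section Generic

variable {K : Type} [Field K] [NumberField K]

/-- **`Tw(T)|_{Γ_{K_q}}` is trivial as soon as `T|_{Γ_{K_{σq}}}` is**, for ANY conjugation datum: `Tw(T)(g) =
T(τ⁻¹ g τ)` and `τ⁻¹ g τ = δ_q · φ_q(g) · δ_q⁻¹` with `φ_q(g) ∈ Γ_{K_{σq}}` (`cd.compat`) — the binder `htrivTw` of the
local files from `htriv'`. [cite: Howard2004HeegnerKolyvagin, §1.3 (arXiv:1202.6340 p. 7 L33–48)] -/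
theorem ConjugationDatum.toLocal_twist_apply_eq_self {M : Type} [AddCommGroup M] [TopologicalSpace M]
    [DiscreteTopology M] (cd : ConjugationDatum K) (ρ : DiscreteGaloisModule K M) (q : HeightOneSpectrum (𝓞 K))
    (htriv' : ∀ (g : absoluteGaloisGroup ((cd.σ • q).adicCompletion K)) (x : M),
      GaloisRep.toLocal (cd.σ • q) ρ g x = x)
    (g : absoluteGaloisGroup (q.adicCompletion K)) (x : M) : GaloisRep.toLocal q (cd.twist ρ) g x = x := by
  rw [GaloisRep.toLocal_apply, ConjugationDatum.twist_apply]
  have hconj : cd.conj (absGaloisRestrict K (q.adicCompletion K) g) =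
      cd.δ q * absGaloisRestrict K ((cd.σ • q).adicCompletion K) (cd.φ q g) * (cd.δ q)⁻¹ := by
    rw [cd.compat q g]; group
  have h1 := htriv' (cd.φ q g) (ρ (cd.δ q)⁻¹ x)
  rw [GaloisRep.toLocal_apply] at h1
  change ρ.toRepresentation (cd.conj (absGaloisRestrict K (q.adicCompletion K) g)) x = x
  change ρ.toRepresentation _ (ρ.toRepresentation _ x) = ρ.toRepresentation _ x at h1
  rw [hconj, map_mul, map_mul, Module.End.mul_apply, Module.End.mul_apply, h1, ← Module.End.mul_apply,
    ← map_mul, mul_inv_cancel, map_one, Module.End.one_apply]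

end Generic

/-! ## §1 The level module `T^{(j)}` of a `DVRSetting` at `q ∈ 𝓛` / `q ∈ 𝓛^{(j)}` -/

section DVR

variable {p : ℕ} [Fact p.Prime] {K : Type} [Field K] [NumberField K]
  {R : Type} [CommRing R] [IsDomain R] [IsDiscreteValuationRing R] [Algebra ℤ_[p] R]
  {N : ℕ → Type} [∀ k, AddCommGroup (N k)] [∀ k, TopologicalSpace (N k)]
  [∀ k, DiscreteTopology (N k)] [∀ k, Module R (N k)]
  {Rk : ℕ → Type} [∀ k, CommRing (Rk k)] [∀ k, IsLocalRing (Rk k)] [∀ k, TopologicalSpace (Rk k)]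
  [∀ k, DiscreteTopology (Rk k)] [∀ k, Algebra ℤ_[p] (Rk k)] [∀ k, Algebra R (Rk k)]
  [∀ k, Module (Rk k) (N k)] [∀ k, IsScalarTower R (Rk k) (N k)]
  {Nbar : Type} [AddCommGroup Nbar] [TopologicalSpace Nbar] [DiscreteTopology Nbar]
  [∀ k, Module (Rk k) Nbar]
  {Nq : ℕ → Finset (HeightOneSpectrum (𝓞 K)) → Type} [∀ k n, AddCommGroup (Nq k n)]
  [∀ k n, TopologicalSpace (Nq k n)] [∀ k n, DiscreteTopology (Nq k n)]
  [∀ k n, Module (Rk k) (Nq k n)] [∀ k n, Module R (Nq k n)]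
  [∀ k n, IsScalarTower R (Rk k) (Nq k n)]

namespace DVRSetting

/-- A prime of `𝓛 ⊂ 𝓛₀(T)` has degree two. [cite: Howard2004HeegnerKolyvagin, §1.2 (arXiv:1202.6340 p. 6 L57–60, L96–99)] -/
theorem isDegreeTwo_of_mem_L (S : DVRSetting p K R N Rk Nbar Nq) (hy : S.SatisfiesH)
    {q : HeightOneSpectrum (𝓞 K)} (hq : q ∈ S.L) : IsDegreeTwo q := by
  have h := hy.L_subset hq
  rw [AdicTower.degreeTwoPrimes, Set.mem_iInter] at h
  exact (h 0).1

/-- A prime of `𝓛 ⊂ 𝓛₀(T)` does not divide `p`. [cite: Howard2004HeegnerKolyvagin, §1.2 (arXiv:1202.6340 p. 6 L57–60)] -/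
theorem natCast_p_not_mem_of_mem_L (S : DVRSetting p K R N Rk Nbar Nq) (hy : S.SatisfiesH)
    {q : HeightOneSpectrum (𝓞 K)} (hq : q ∈ S.L) : ((p : ℕ) : 𝓞 K) ∉ q.asIdeal := by
  have h := hy.L_subset hq
  rw [AdicTower.degreeTwoPrimes, Set.mem_iInter] at h
  exact (h 0).2.1

/-- Every level `T^{(j)}` is unramified at a prime of `𝓛 ⊂ 𝓛₀(T)`. [cite: Howard2004HeegnerKolyvagin, §1.2 (arXiv:1202.6340 p. 6 L57–60)] -/
theorem isUnramifiedAt_of_mem_L (S : DVRSetting p K R N Rk Nbar Nq) (hy : S.SatisfiesH)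
    {q : HeightOneSpectrum (𝓞 K)} (hq : q ∈ S.L) (j : ℕ) : GaloisRep.IsUnramifiedAt q (S.T.ρ j) := by
  have h := hy.L_subset hq
  rw [AdicTower.degreeTwoPrimes, Set.mem_iInter] at h
  exact (h j).2.2

/-- `residueChar (σ • q) = residueChar q` for `q ∈ 𝓛`. [cite: Howard2004HeegnerKolyvagin, §1.2 (arXiv:1202.6340 p. 6 L57–60)] -/
theorem residueChar_sigma_smul_of_mem_L (S : DVRSetting p K R N Rk Nbar Nq) (hy : S.SatisfiesH)
    {q : HeightOneSpectrum (𝓞 K)} (hq : q ∈ S.L) : residueChar (S.cd.σ • q) = residueChar q := by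
  rw [S.sigma_smul_eq_self_of_mem_L hy hq]

/-- **`p^{e_j} · T^{(j)} = 0`** (`p ∈ 𝔪`, `𝔪^{e_j}` kills the level): the binder `hn` of the local files with
`k' := e_j`. [cite: Howard2004HeegnerKolyvagin, §1.6 (arXiv:1202.6340 p. 11 L13–17, L33–36)] -/
theorem pow_p_e_smul_eq_zero_level (S : DVRSetting p K R N Rk Nbar Nq) (hy : S.SatisfiesH) (j : ℕ) (y : N j) :
    p ^ S.e j • y = 0 := by
  have h := hy.killed j _ (Ideal.pow_mem_pow (S.natCast_p_mem_maximalIdeal hy) (S.e j)) y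
  rwa [← Nat.cast_pow, Nat.cast_smul_eq_nsmul] at h

/-- `T^{(j)}` is `p`-primary: the binder `hp` of the local files. [cite: Howard2004HeegnerKolyvagin, §1.6 (arXiv:1202.6340 p. 11 L33–36)] -/
theorem exists_pow_p_smul_eq_zero_level (S : DVRSetting p K R N Rk Nbar Nq) (hy : S.SatisfiesH) (j : ℕ)
    (y : N j) : ∃ m : ℕ, p ^ m • y = 0 :=
  ⟨S.e j, S.pow_p_e_smul_eq_zero_level hy j y⟩

/-- `T^{(j)}` is `p`-primary torsion (tree predicate). [cite: Howard2004HeegnerKolyvagin, §1.6 (arXiv:1202.6340 p. 11 L33–36)] -/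
theorem isPrimaryTorsion_level (S : DVRSetting p K R N Rk Nbar Nq) (hy : S.SatisfiesH) (j : ℕ) :
    IsPrimaryTorsion p (N j) :=
  fun y => S.exists_pow_p_smul_eq_zero_level hy j y

/-- **The level ring `R_j` is `p`-primary torsion** (`p^{e_j} · R_j = 0`): the binder `hRp` of the local files.
[cite: Howard2004HeegnerKolyvagin, §1.6 (arXiv:1202.6340 p. 11 L13–17)] -/
theorem isPrimaryTorsion_levelRing (S : DVRSetting p K R N Rk Nbar Nq) (hy : S.SatisfiesH) (j : ℕ) :
    IsPrimaryTorsion p (Rk j) :=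
  fun r => ⟨S.e j, S.natCast_pow_smul_levelRing_eq_zero hy j (S.natCast_pow_mem_maximalIdeal_pow_of_le hy le_rfl) r⟩

/-- `p^m` is odd (`p ≠ 2`, T2): the binder `hN` of the local files with `N := p^{k'}`.
[cite: Howard2004HeegnerKolyvagin, §1 (journal: `p` odd)] -/
theorem odd_pow_p (S : DVRSetting p K R N Rk Nbar Nq) (hy : S.SatisfiesH) (m : ℕ) : Odd (p ^ m) :=
  ((Fact.out : p.Prime).odd_of_ne_two hy.p_odd).pow

/-- **`(ℓ + 1) · T^{(j)} = 0` for `q ∈ 𝓛^{(j)} = 𝓛 ∩ 𝓛_{e_j}(T)`** (`ℓ + 1 ∈ p^{e_j} R ⊆ 𝔪^{e_j}`): Howard's Kolyvagin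
condition in the shape the Prop. 1.1.9 files consume (`hℓT`).
[cite: Howard2004HeegnerKolyvagin, Def. 1.2.1 and §1.6 (arXiv:1202.6340 p. 6 L63–68, p. 11 L33–38)] -/
theorem residueChar_succ_smul_eq_zero_of_mem_levelPrimes (S : DVRSetting p K R N Rk Nbar Nq) (hy : S.SatisfiesH)
    {j : ℕ} {q : HeightOneSpectrum (𝓞 K)} (hq : q ∈ S.levelPrimes j) (y : N j) :
    (residueChar q + 1) • y = 0 := by
  obtain ⟨a, ha⟩ := Ideal.mem_span_singleton'.mp hq.2.2.1
  have hmem : ((residueChar q + 1 : ℕ) : R) ∈ IsLocalRing.maximalIdeal R ^ S.e j := by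
    rw [← ha]
    exact Ideal.mul_mem_left _ _ (Ideal.pow_mem_pow (S.natCast_p_mem_maximalIdeal hy) _)
  have h := hy.killed j _ hmem y
  rwa [Nat.cast_smul_eq_nsmul] at h

/-- **`Tw(T^{(j)})|_{Γ_{K_q}}` is trivial for `q ∈ n ⊆ 𝓛^{(j)}`**: the binder `htrivTw` of the local files,
discharged (HTRIV at `σ • q = q` + `toLocal_twist_apply_eq_self`).
[cite: Howard2004HeegnerKolyvagin, §1.3 and §1.6 (arXiv:1202.6340 p. 7 L33–48, p. 11 L33–38)] -/
theorem toLocal_twist_apply_eq_self_of_subset_levelPrimes (S : DVRSetting p K R N Rk Nbar Nq) (hy : S.SatisfiesH)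
    {j : ℕ} {n : Finset (HeightOneSpectrum (𝓞 K))} (hn : ↑n ⊆ S.levelPrimes j) {q : HeightOneSpectrum (𝓞 K)}
    (hq : q ∈ n) (g : absoluteGaloisGroup (q.adicCompletion K)) (y : N j) :
    GaloisRep.toLocal q (S.cd.twist (S.T.ρ j)) g y = y := by
  have hσq : S.cd.σ • q ∈ n := by rwa [S.sigma_smul_eq_self_of_mem_L hy (hn hq).1]
  exact S.cd.toLocal_twist_apply_eq_self (S.T.ρ j) q
    (fun g' x => S.toLocal_apply_eq_self_of_subset_levelPrimes hy hn hσq g' x) g y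

/-- `htriv'` — triviality of `Γ_{K_{σq}}` on `T^{(j)}` — for `q ∈ n ⊆ 𝓛^{(j)}` (HTRIV at the prime `σ • q = q`).
[cite: Howard2004HeegnerKolyvagin, Def. 1.1.8 and §1.6 (arXiv:1202.6340 p. 5 L126–131, p. 11 L33–38)] -/
theorem toLocal_sigma_smul_apply_eq_self_of_subset_levelPrimes (S : DVRSetting p K R N Rk Nbar Nq)
    (hy : S.SatisfiesH) {j : ℕ} {n : Finset (HeightOneSpectrum (𝓞 K))} (hn : ↑n ⊆ S.levelPrimes j)
    {q : HeightOneSpectrum (𝓞 K)} (hq : q ∈ n) (g : absoluteGaloisGroup ((S.cd.σ • q).adicCompletion K))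
    (y : N j) : GaloisRep.toLocal (S.cd.σ • q) (S.T.ρ j) g y = y := by
  have hσq : S.cd.σ • q ∈ n := by rwa [S.sigma_smul_eq_self_of_mem_L hy (hn hq).1]
  exact S.toLocal_apply_eq_self_of_subset_levelPrimes hy hn hσq g y


/-! ## §2 Prop. 1.1.9 at the level module `T^{(j)}` and a prime `q ∈ 𝓛^{(j)}` -/

/-- **Howard Prop. 1.1.9 AT THE LEVEL: `H¹(K_q, T^{(j)}) = H¹_f ⊕ H¹_tr`** for `q ∈ 𝓛^{(j)} = 𝓛 ∩ 𝓛_{e_j}(T)`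
(`d_K < −4`): the unramified subgroup and Howard's transverse condition are complementary — every printed hypothesis
(`q` degree two, `Γ_{K_q}` trivial on `T^{(j)}`, `T^{(j)}` finite `p`-primary, `(ℓ + 1) · T^{(j)} = 0`) discharged
from `S.SatisfiesH`. [cite: Howard2004HeegnerKolyvagin, Prop. 1.1.9 and §1.6 (arXiv:1202.6340 p. 6 L17–25, p. 11 L33–38)] -/
theorem isCompl_unramifiedSubgroup_transverseStructure_of_mem_levelPrimes (S : DVRSetting p K R N Rk Nbar Nq)
    (hy : S.SatisfiesH) (hd : NumberField.discr K < -4) {j : ℕ} {q : HeightOneSpectrum (𝓞 K)}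
    (hq : q ∈ S.levelPrimes j) :
    IsCompl (unramifiedSubgroup (GaloisRep.toLocal q (S.T.ρ j)) 1)
      (transverseStructure p (S.T.ρ j) S.jbar (Sum.inr q)) := by
  haveI : Finite (N j) := S.finite_level hy j
  have hn : ↑({q} : Finset (HeightOneSpectrum (𝓞 K))) ⊆ S.levelPrimes j := by
    rw [Finset.coe_singleton, Set.singleton_subset_iff]; exact hq
  exact isCompl_unramifiedSubgroup_transverseStructure_of_isDegreeTwo p hy.imagQuad hd (S.T.ρ j) S.jbar
    (S.isDegreeTwo_of_mem_L hy hq.1)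
    (fun g x => S.toLocal_apply_eq_self_of_subset_levelPrimes hy hn (Finset.mem_singleton_self q) g x)
    (S.exists_pow_p_smul_eq_zero_level hy j) (S.residueChar_succ_smul_eq_zero_of_mem_levelPrimes hy hq)

/-- **`#H¹_tr(K_q, T^{(j)}) · #H¹_tr(K_{σq}, T^{(j)}) = #H¹(K_q, T^{(j)})`** for `q ∈ 𝓛^{(j)}` (`σ • q = q`): the
binder `hcard` of the isotropy-count criterion for H.4 at `λ ∣ n` (`SelfOrthogonalOfIsotropicCountProofs`), discharged.
[cite: Howard2004HeegnerKolyvagin, Prop. 1.1.9 and Lemma 1.5.6 (arXiv:1202.6340 p. 6 L17–25, p. 10 L86–88)] -/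
theorem natCard_transverseStructure_mul_eq_of_mem_levelPrimes (S : DVRSetting p K R N Rk Nbar Nq)
    (hy : S.SatisfiesH) (hd : NumberField.discr K < -4) {j : ℕ} {q : HeightOneSpectrum (𝓞 K)}
    (hq : q ∈ S.levelPrimes j) :
    Nat.card (transverseStructure p (S.T.ρ j) S.jbar (Sum.inr q)) *
        Nat.card (transverseStructure p (S.T.ρ j) S.jbar (Sum.inr (S.cd.σ • q))) =
      Nat.card (galoisCohomology ((S.T.ρ j).toLocal (Sum.inr q)) 1) := by
  haveI : Finite (N j) := S.finite_level hy j
  have hn : ↑({q} : Finset (HeightOneSpectrum (𝓞 K))) ⊆ S.levelPrimes j := by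
    rw [Finset.coe_singleton, Set.singleton_subset_iff]; exact hq
  exact natCard_transverseStructure_mul_eq_of_isDegreeTwo p hy.imagQuad hd (S.T.ρ j) S.jbar
    (S.isDegreeTwo_of_mem_L hy hq.1) (S.residueChar_sigma_smul_of_mem_L hy hq.1)
    (fun g x => S.toLocal_apply_eq_self_of_subset_levelPrimes hy hn (Finset.mem_singleton_self q) g x)
    (fun g x => S.toLocal_sigma_smul_apply_eq_self_of_subset_levelPrimes hy hn (Finset.mem_singleton_self q) g x)
    (S.exists_pow_p_smul_eq_zero_level hy j) (S.residueChar_succ_smul_eq_zero_of_mem_levelPrimes hy hq)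

/-- **A tame generator at `q ∈ 𝓛`**: some `σ₀ ∈ I_{K_q}` with `Γ_{K_q} = ⋃_i σ₀^i · (Γ_{K_q} ∩ Γ_{K[ℓ]})` — the
binders `σ₀`, `hcyc` of the local files, discharged (`d_K < −4`).
[cite: Howard2004HeegnerKolyvagin, §1.2 (arXiv:1202.6340 p. 6 L84–95)] [cite: GrossLMS1991, §3 (PDF p. 217 l. 1–3)] -/
theorem exists_mem_absInertia_forall_pow_inv_mul_mem_localRingClassSubgroup_of_mem_L
    (S : DVRSetting p K R N Rk Nbar Nq) (hy : S.SatisfiesH) (hd : NumberField.discr K < -4)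
    {q : HeightOneSpectrum (𝓞 K)} (hq : q ∈ S.L) :
    ∃ σ₀ : absoluteGaloisGroup (q.adicCompletion K), σ₀ ∈ absInertia (q.adicCompletion K) ∧
      ∀ σ : absoluteGaloisGroup (q.adicCompletion K), ∃ i : ℕ,
        (σ₀ ^ i)⁻¹ * σ ∈ localRingClassSubgroup (residueChar q) S.jbar q :=
  exists_forall_pow_inv_mul_mem_localRingClassSubgroup_of_isDegreeTwo hy.imagQuad hd S.jbar
    (S.isDegreeTwo_of_mem_L hy hq)

/-- **`T^{(j)} ≅ (R/π^{e_j})²` as an `R`-module** (H.0: `T^{(j)}` free of rank two over `R_j = R/𝔪^{e_j} = R/π^{e_j}`).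
[cite: Howard2004HeegnerKolyvagin, §1.3 H.0 and §1.6 (arXiv:1202.6340 p. 7 L57, p. 11 L13–17, L33–34)] -/
theorem nonempty_level_linearEquiv_pi (S : DVRSetting p K R N Rk Nbar Nq) (hy : S.SatisfiesH) (j : ℕ) :
    Nonempty (N j ≃ₗ[R] (Fin 2 → R ⧸ Ideal.span {S.π ^ S.e j})) := by
  haveI : Module.Free (Rk j) (N j) := (hy.h0 j).1
  haveI : Module.Finite (Rk j) (N j) := Module.finite_of_finrank_eq_succ (hy.h0 j).2
  let b := Module.finBasisOfFinrankEq (Rk j) (N j) (hy.h0 j).2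
  let e1 : N j ≃ₗ[R] (Fin 2 → Rk j) := b.equivFun.restrictScalars R
  have hsurj : Function.Surjective (Algebra.ofId R (Rk j)) := hy.algebraMap_surjective j
  have hker : RingHom.ker (Algebra.ofId R (Rk j)) = Ideal.span {S.π ^ S.e j} := by
    have h := hy.ker_algebraMap j
    rw [hy.unif, Ideal.span_singleton_pow] at h
    exact h
  let e2 : (R ⧸ Ideal.span {S.π ^ S.e j}) ≃ₐ[R] Rk j :=
    (Ideal.quotientEquivAlgOfEq R hker.symm).trans (Ideal.quotientKerAlgEquivOfSurjective hsurj)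
  exact ⟨e1.trans (LinearEquiv.piCongrRight fun _ => e2.symm.toLinearEquiv)⟩

/-- **Prop. 1.1.9 `R`-linearly at the level, in the exact shape of the Lagrangian transfer (`hc`, `ef`, `etr` of
`DualityDatum.smul_le_ker_of_smul_le_ker_of_inert_local`)**: for `q ∈ 𝓛^{(j)}` (`d_K < −4`) there are `R`-submodules
`SVf`, `SVtr` of `H¹(K_q, T^{(j)})` (Howard's scalar structure `moduleH1` through `R`) with underlying subgroups
`H¹_ur = 𝓕_q` and `H¹_tr = 𝒯_q`, complementary, and both `≃ₗ[R] (R/π^{e_j})²` («`H¹(K_λ,T) = H¹_f ⊕ H¹_tr`, free of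
rank two» for `T = T^{(j)} ≅ R_j²`).
[cite: Howard2004HeegnerKolyvagin, Prop. 1.1.9, §1.5, §1.6 (arXiv:1202.6340 p. 6 L17–25, p. 9 L105–108, p. 11 L33–44)] -/
theorem exists_unramified_transverse_submodules_of_mem_levelPrimes (S : DVRSetting p K R N Rk Nbar Nq)
    (hy : S.SatisfiesH) (hd : NumberField.discr K < -4) {j : ℕ} {q : HeightOneSpectrum (𝓞 K)}
    (hq : q ∈ S.levelPrimes j) :
    letI := galoisCohomology.moduleH1 ((S.T.ρ j).toLocal (Sum.inr q))
      ((S.T.hlin j).restrictField (Place.Completion (Sum.inr q)))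
    ∃ SVf SVtr : Submodule R (galoisCohomology ((S.T.ρ j).toLocal (Sum.inr q)) 1),
      SVf.toAddSubgroup = unramifiedSubgroup (GaloisRep.toLocal q (S.T.ρ j)) 1 ∧
      SVtr.toAddSubgroup = transverseStructure p (S.T.ρ j) S.jbar (Sum.inr q) ∧
      IsCompl SVf SVtr ∧
      Nonempty (↥SVf ≃ₗ[R] (Fin 2 → R ⧸ Ideal.span {S.π ^ S.e j})) ∧
      Nonempty (↥SVtr ≃ₗ[R] (Fin 2 → R ⧸ Ideal.span {S.π ^ S.e j})) := by
  haveI : Finite (N j) := S.finite_level hy j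
  have hn : ↑({q} : Finset (HeightOneSpectrum (𝓞 K))) ⊆ S.levelPrimes j := by
    rw [Finset.coe_singleton, Set.singleton_subset_iff]; exact hq
  have hρv : DiscreteGaloisModule.IsScalarLinear R (GaloisRep.toLocal q (S.T.ρ j)) :=
    (S.T.hlin j).restrictField (Place.Completion (Sum.inr q))
  obtain ⟨Vtr, hVtr, hc, ⟨ef⟩, ⟨etr⟩⟩ := exists_transverse_submodule_isCompl_linearEquiv_of_isDegreeTwo p
    hy.imagQuad hd (S.T.ρ j) S.jbar (S.isDegreeTwo_of_mem_L hy hq.1) hρv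
    (fun g x => S.toLocal_apply_eq_self_of_subset_levelPrimes hy hn (Finset.mem_singleton_self q) g x)
    (S.exists_pow_p_smul_eq_zero_level hy j) (S.residueChar_succ_smul_eq_zero_of_mem_levelPrimes hy hq)
  obtain ⟨eN⟩ := S.nonempty_level_linearEquiv_pi hy j
  exact ⟨DiscreteGaloisModule.unramifiedSubmodule hρv, Vtr, DiscreteGaloisModule.toAddSubgroup_unramifiedSubmodule hρv,
    hVtr, hc, ⟨ef.trans eN⟩, ⟨etr.trans eN⟩⟩

/-! ## §3 The Selmer-structure bookkeeping at the level (`𝓕_q = H¹_ur`, `Σ(F)`, no archimedean term) -/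

/-- **`𝓕_q = H¹_ur(K_q, T^{(j)})` for `q ∈ 𝓛`** (`𝓛 ∩ Σ(F) = ∅`, `F` unramified outside `Σ(F)`): the binder `h𝓕q`.
[cite: Howard2004HeegnerKolyvagin, Def. 1.1.10 and §1.2 (arXiv:1202.6340 p. 6 L10–24, L96–99)] -/
theorem cond_inr_eq_unramifiedSubgroup_of_mem_L (S : DVRSetting p K R N Rk Nbar Nq) (hy : S.SatisfiesH) (j : ℕ)
    {q : HeightOneSpectrum (𝓞 K)} (hq : q ∈ S.L) :
    (S.t j).cond (Sum.inr q) = unramifiedSubgroup (GaloisRep.toLocal q (S.T.ρ j)) 1 :=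
  (S.t j).cond_inr_eq_of_mem (by rw [hy.primes_eq]; exact hq)

/-- **Outside `Σ(F)` a finite place neither divides `p^m` nor ramifies in `T^{(j)}`** (Def. 1.1.10): the binder `hS`
of the local files for the set `Σ(F)` (and any superset). [cite: Howard2004HeegnerKolyvagin, Def. 1.1.10 (arXiv:1202.6340 p. 6 L10–14)] -/
theorem not_mem_and_isUnramifiedAt_of_not_mem_Sigma (S : DVRSetting p K R N Rk Nbar Nq) (j m : ℕ)
    (v : HeightOneSpectrum (𝓞 K)) (hv : (Sum.inr v : Place K) ∉ (S.t j).Sigma) :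
    ((p ^ m : ℕ) : 𝓞 K) ∉ v.asIdeal ∧ GaloisRep.IsUnramifiedAt v (S.T.ρ j) := by
  refine ⟨fun h => hv ((S.t j).isHoward.mem_of_dvd v ?_), ?_⟩
  · rw [Nat.cast_pow] at h
    exact v.isPrime.mem_of_pow_mem _ h
  · by_contra h
    exact hv ((S.t j).isHoward.mem_of_ramified v h)

/-- **No archimedean contribution: `H¹(K_w, T^{(j)}) = 0` at every infinite place** (`p` odd, `T^{(j)}` `p`-primary;
for `K` imaginary quadratic `Γ_{K_w}` is even trivial). [cite: Howard2004HeegnerKolyvagin, Def. 1.1.10 (arXiv:1202.6340 p. 6 L10–14: all archimedean places lie in `Σ(F)`)] [cite: NeukirchSchmidtWingberg2008, (8.6.10)(ii)] -/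
theorem subsingleton_galoisCohomology_toLocal_inl_level (S : DVRSetting p K R N Rk Nbar Nq) (hy : S.SatisfiesH)
    (j : ℕ) (w : InfinitePlace K) {r : ℕ} (hr : 1 ≤ r) :
    Subsingleton (galoisCohomology ((S.T.ρ j).toLocal (Sum.inl w)) r) :=
  subsingleton_galoisCohomology_toLocal_inl_of_ne_two w hy.p_odd (S.T.ρ j) (S.isPrimaryTorsion_level hy j) hr

/-- The binder `hinf` of the local files: every class of `H¹(K, T^{(j)})` localises to `0` at the infinite places.
[cite: Howard2004HeegnerKolyvagin, Def. 1.1.10 (arXiv:1202.6340 p. 6 L10–14)] [cite: NeukirchSchmidtWingberg2008, (8.6.10)(ii)] -/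
theorem localization_inl_eq_zero_level (S : DVRSetting p K R N Rk Nbar Nq) (hy : S.SatisfiesH) (j : ℕ)
    (w : InfinitePlace K) (c : galoisCohomology (S.T.ρ j) 1) :
    galoisCohomology.localization (S.T.ρ j) (Sum.inl w) 1 c = 0 := by
  haveI := S.subsingleton_galoisCohomology_toLocal_inl_level hy j w le_rfl
  exact Subsingleton.elim _ _

end DVRSetting

namespace SelmerTriple

variable {M : Type} [AddCommGroup M] [TopologicalSpace M] [DiscreteTopology M] {ρ : DiscreteGaloisModule K M}

/-- Reading `F(n)`: the condition of `t.atLevel jbar n` IS `t.cond.modify 𝒯 ∅ ∅ n` with `𝒯` Howard's transverse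
structure (definitional) — the currency of `SelmerStructureModifyOnePlaceProofs` / H159-LOC.
[cite: Howard2004HeegnerKolyvagin, Def. 1.2.2 (arXiv:1202.6340 p. 6 L101–125)] -/
theorem atLevel_cond (t : SelmerTriple p ρ) (jbar : AlgebraicClosure K →+* ℂ)
    (n : Finset (HeightOneSpectrum (𝓞 K))) :
    (t.atLevel jbar n).cond = t.cond.modify (transverseStructure p ρ jbar) ∅ ∅ n := rfl

open scoped Classical in
/-- `Σ(F^a_b(c)) = Σ(F) ∪ {λ ∣ abc}` (definitional). [cite: Howard2004HeegnerKolyvagin, Def. 1.2.2 (arXiv:1202.6340 p. 6 L101–105)] -/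
theorem modify_Sigma (t : SelmerTriple p ρ) (jbar : AlgebraicClosure K →+* ℂ)
    (a b c : Finset (HeightOneSpectrum (𝓞 K))) :
    (t.modify jbar a b c).Sigma = t.Sigma ∪ (a ∪ b ∪ c).image Sum.inr := rfl

open scoped Classical in
/-- **`F^a_b(c)` is unramified outside `Σ(F) ∪ {λ ∣ abc}`**: the binder `h𝓡S` of the local files (for `𝓡 = F^q(n)`:
`a = {q}`, `b = ∅`, `c = n`). [cite: Howard2004HeegnerKolyvagin, Def. 1.1.10 and Def. 1.2.2 (arXiv:1202.6340 p. 6 L10–14, L101–125)] -/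
theorem isUnramifiedOutside_modify_cond (t : SelmerTriple p ρ) (jbar : AlgebraicClosure K →+* ℂ)
    (a b c : Finset (HeightOneSpectrum (𝓞 K))) :
    (t.cond.modify (transverseStructure p ρ jbar) a b c).IsUnramifiedOutside (t.Sigma ∪ (a ∪ b ∪ c).image Sum.inr) :=
  (t.modify jbar a b c).isHoward.isUnramifiedOutside

end SelmerTriple

end DVR

end Literature.NumberTheory.GaloisCohomology.Howard2004

end
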